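import Literature.Analysis.Complex.LittlewoodLemma
import Mathlib.Analysis.SpecialFunctions.Trigonometric.DerivHyp
import HarnessLib

/-!
# Selberg's argument principle on a box with the kernel `cos(π(s − W₀ + iH)/(2iH))`
# (Conrey–Soundararajan 2002, Lemma 2.1, "due to Selberg")

Topic `Literature/Analysis/Complex` (namespace `Literature.Analysis.Complex`; the kernel objects in the
sub-namespace `SelbergBox`). STATEMENT LAYER: ONE named fact (D-0014, `def … : Prop`, not proved
here) — the box lemma — plus PROVED bookkeeping: the zero weights are non-negative on the box (this
is what makes the identity a zero DETECTOR: every zero of `f` in the box enters the left side with a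
sign `≥ 0`, so an upper bound for the three boundary integrals bounds a non-negatively weighted count
of zeros; Conrey–Soundararajan (2.1)–(2.3)).

Companions in this directory (different kernels, all PROVED): the weighted argument principle
`Literature.Analysis.Complex.rectBoundaryIntegral_logDeriv_mul_eq_sum` (`WeightedArgumentPrinciple.lean`),
Littlewood's lemma `Literature.Analysis.Complex.littlewood_lemma` (`LittlewoodLemma.lean`, weight
`Re ρ − a`), Ford's detector (`FordZeroDetector.lean`). Selberg's kernel is the one whose weight
VANISHES on three edges of the box (left edge: `sinh 0 = 0`; top/bottom: `cos(±π/2) = 0`) and which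
is real on the left edge and purely imaginary on the horizontal edges, so that only `log |f|` is
needed on those three sides and `log f` only on the right edge (inside the half-plane of absolute
convergence in the applications) — Conrey–Soundararajan, §2, last two paragraphs of p0004 of the held
text ("Selberg's argument principle (Lemma 2.1) allows us to circumvent this …"; "The chief drawback
with Selberg's lemma is the exponential growth of the kernel … on the horizontal sides").

## What the source prints (held text `paper:arxiv-math_0111013`, corpus-tex, chunk p0001:L89–L150, read 2026-08-26)

J. B. Conrey, K. Soundararajan, *Real zeros of quadratic Dirichlet `L`-functions*, Invent. Math. 150
(2002) 1–44 [ConreySoundararajan2002], §2 "Outline of the proof": "We begin with the following version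
of the argument principle, due to Selberg [10], whose proof we reproduce for completeness."
([10] = A. Selberg, *Contributions to the theory of Dirichlet's `L`-functions*, Skr. Norske Vid. Akad.
Oslo I (1946) 1–62 — not held; the lemma is typed from Conrey–Soundararajan's printed statement and
proof.)

> **Lemma 2.1.** Let `f` be a holomorphic function, which is non-zero in some half-plane
> `Re(z) ≥ W`. Let `𝓑` be the rectangular box with vertices `W₀ ± iH`, `W₁ ± iH` where `H > 0` and
> `W₀ < W < W₁`. Then
> `4H Σ_{β+iγ ∈ 𝓑, f(β+iγ) = 0} cos(πγ/(2H)) sinh(π(β − W₀)/(2H))`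
> `  = ∫_{−H}^{H} cos(πt/(2H)) log|f(W₀ + it)| dt`
> `  + ∫_{W₀}^{W₁} sinh(π(α − W₀)/(2H)) log|f(α + iH) f(α − iH)| dα`
> `  − Re ∫_{−H}^{H} cos(π (W₁ − W₀ + it)/(2iH)) log f(W₁ + it) dt.`

Printed proof (p0001:L112–L150): exclude from `𝓑` the horizontal cuts from each zero `β + iγ` to
`W₀ + iγ`; on the resulting domain `∫_Γ cos(π(s − W₀)/(2iH)) log f(s) ds = 0`; `log f` jumps by `2πi`
across each cut, which produces the left side (zeros "in `𝓑`", with multiplicity, as the jump count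
shows); the imaginary parts of the four edge integrals are the three printed terms (the kernel is real
on `Re s = W₀` and purely imaginary on `Im s = ±H`).

## Lean rendering / design choices (audit notes for ls-lit-ref)

* "`f` holomorphic" with no domain named = an ENTIRE function: `Differentiable ℂ f` (the application
  is `f = L(s, χ_{−8d}) M(s, d)`, entire). "non-zero in some half-plane `Re z ≥ W`":
  `∀ z, W ≤ z.re → f z ≠ 0`, with `W₀ < W < W₁` and `0 < H` as printed.
* The zero sum: over the zeros of `f` in the CLOSED box `[W₀, W₁] × [−H, H]` (printed "`β + iγ ∈ 𝓑`"),
  each weighted by its multiplicity `analyticOrderNatAt f ρ` (Mathlib) — a `finsum` (the zero set of a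
  not-identically-zero entire function in a compact box is finite; `f ≢ 0` because `f(W₁) ≠ 0`).
  Zeros ON the left/top/bottom edges carry the weight `0` (`sinh 0`, `cos(±π/2)`), and there are none
  on the right edge (`W < W₁`), so "open box" and "closed box" give the same sum; no hypothesis
  "`f ≠ 0` on `∂𝓑`" is printed and none is added.
* "`log f(W₁ + it)`": a continuous logarithm of `t ↦ f(W₁ + it)` on `[−H, H]` (it exists: `f ≠ 0`
  there). The identity is stated for EVERY continuous branch `Λ` (`exp (Λ t) = f(W₁ + it)`): two
  branches differ by a constant `2πik`, and `Re(2πik ∫_{−H}^{H} cos(π(W₁ − W₀ + it)/(2iH)) dt) = 0`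
  because `∫_{−H}^{H} cos(π(W₁ − W₀ + it)/(2iH)) dt = (4H/π) cosh(π(W₁ − W₀)/(2H))` is real
  (`cos(x − iy) = cos x cosh y + i sin x sinh y`, the `sin` part is odd in `t`). So the choice of
  branch printed as "`log f`" is immaterial, and the universally quantified form is equivalent to the
  printed one.
* `log|·|` is `Real.log ‖·‖`; the integrals are Mathlib interval integrals (Lebesgue; the integrands
  are continuous except for integrable logarithmic singularities at boundary zeros, if any).
* The right-edge kernel `cos(π(W₁ − W₀ + it)/(2iH))` is `SelbergBox.rightKernel`, written literally.

WHAT THIS IS NOT: no claim about `L`-functions; the lemma is pure complex analysis. Not proved here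
(the tree's `WeightedArgumentPrinciple.lean` / `LittlewoodLemma.lean` toolkit — primitive of `f′/f`
along edges, division by `(z − ρ)^m` — is the natural road for a discharge; estimate: M, ≤ 400 lines).

## References

* [ConreySoundararajan2002] J. B. Conrey, K. Soundararajan, Invent. Math. 150 (2002) 1–44 =
  arXiv:math/0111013, §2, Lemma 2.1 with proof (held text p0001:L89–L150), and the discussion at the
  end of §2 (p0004).
* A. Selberg, *Contributions to the theory of Dirichlet's `L`-functions*, Skr. Norske Vid.-Akad. Oslo
  I, 1946, no. 3, 1–62 (the original; cited through [ConreySoundararajan2002, ref. 10]; not held).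
-/

noncomputable section

open _root_.Complex Set MeasureTheory intervalIntegral

namespace Literature.Analysis.Complex

namespace SelbergBox

/-- **Selberg's zero weight** `cos(πγ/(2H)) · sinh(π(β − W₀)/(2H))` attached to a zero `ρ = β + iγ`
of `f` in the box `[W₀, W₁] × [−H, H]` (the left side of Lemma 2.1 is `4H Σ_ρ m(ρ) · weight`).
[cite: ConreySoundararajan2002, §2 Lemma 2.1] -/
def weight (W₀ H : ℝ) (ρ : ℂ) : ℝ :=
  Real.cos (Real.pi * ρ.im / (2 * H)) * Real.sinh (Real.pi * (ρ.re - W₀) / (2 * H))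

/-- **The right-edge kernel** `cos(π (W₁ − W₀ + it)/(2iH))` of Lemma 2.1 (the value at
`s = W₁ + it` of Selberg's kernel `cos(π(s − W₀)/(2iH))`), written literally.
[cite: ConreySoundararajan2002, §2 Lemma 2.1] -/
def rightKernel (W₀ W₁ H t : ℝ) : ℂ :=
  Complex.cos (Real.pi * (((W₁ - W₀ : ℝ) : ℂ) + t * I) / (2 * I * H))

/-- **Detector sign**: on the closed box `[W₀, W₁] × [−H, H]` (`H > 0`) Selberg's zero weight is
non-negative — `|γ| ≤ H` gives `cos(πγ/(2H)) ≥ 0` and `β ≥ W₀` gives `sinh(π(β − W₀)/(2H)) ≥ 0`.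
This is the remark "Since the LHS of Lemma 2.1 consists of positive terms" preceding (2.1) of the
source. [cite: ConreySoundararajan2002, §2 (2.1)] -/
theorem weight_nonneg {W₀ W₁ H : ℝ} (hH : 0 < H) {ρ : ℂ} (hρ : ρ ∈ Icc W₀ W₁ ×ℂ Icc (-H) H) :
    0 ≤ weight W₀ H ρ := by
  obtain ⟨⟨hre₁, _⟩, ⟨him₁, him₂⟩⟩ := hρ
  unfold weight
  refine mul_nonneg ?_ ?_
  · apply Real.cos_nonneg_of_mem_Icc
    have h2H : 0 < 2 * H := by linarith
    constructor
    · rw [le_div_iff₀ h2H]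
      nlinarith [Real.pi_pos]
    · rw [div_le_iff₀ h2H]
      nlinarith [Real.pi_pos]
  · rw [Real.sinh_nonneg_iff]
    apply div_nonneg _ (by linarith)
    exact mul_nonneg Real.pi_pos.le (by linarith)

/-- A zero of weight zero: on the LEFT edge `β = W₀` the weight vanishes (`sinh 0 = 0`), so zeros on
that edge do not enter the left side of Lemma 2.1. [cite: ConreySoundararajan2002, §2 Lemma 2.1] -/
theorem weight_eq_zero_of_re_eq {W₀ H : ℝ} {ρ : ℂ} (hρ : ρ.re = W₀) : weight W₀ H ρ = 0 := by
  simp [weight, hρ]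

/-- On the HORIZONTAL edges `γ = ±H` (`H ≠ 0`) the weight vanishes (`cos(±π/2) = 0`).
[cite: ConreySoundararajan2002, §2 Lemma 2.1] -/
theorem weight_eq_zero_of_abs_im_eq {W₀ H : ℝ} (hH : H ≠ 0) {ρ : ℂ} (hρ : |ρ.im| = H) :
    weight W₀ H ρ = 0 := by
  unfold weight
  have hH0 : 0 ≤ H := hρ ▸ abs_nonneg _
  rcases (abs_eq hH0).mp hρ with h1 | h1
  · have : Real.pi * ρ.im / (2 * H) = Real.pi / 2 := by
      rw [h1]; field_simp
    rw [this, Real.cos_pi_div_two, zero_mul]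
  · have : Real.pi * ρ.im / (2 * H) = -(Real.pi / 2) := by
      rw [h1]; field_simp
    rw [this, Real.cos_neg, Real.cos_pi_div_two, zero_mul]

end SelbergBox

/-- **Selberg's box lemma (Conrey–Soundararajan 2002, Lemma 2.1; Selberg 1946)** — NAMED FACT, AS
PRINTED. Let `f` be an entire function, non-zero on a half-plane `Re z ≥ W`, and let `𝓑` be the box
with vertices `W₀ ± iH`, `W₁ ± iH`, `H > 0`, `W₀ < W < W₁`. Then, for any continuous branch `Λ` of
`log f(W₁ + it)` on `[−H, H]`,
`4H Σ_{ρ = β+iγ ∈ 𝓑, f(ρ) = 0} m(ρ) cos(πγ/(2H)) sinh(π(β − W₀)/(2H))`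
`= ∫_{−H}^{H} cos(πt/(2H)) log|f(W₀ + it)| dt + ∫_{W₀}^{W₁} sinh(π(α − W₀)/(2H)) log|f(α + iH) f(α − iH)| dα`
`  − Re ∫_{−H}^{H} cos(π(W₁ − W₀ + it)/(2iH)) Λ(t) dt`
(zeros with multiplicity `m(ρ)`; the value does not depend on the branch `Λ`, see the module
docstring). Status: theorem-in-print, not proved here. [cite: ConreySoundararajan2002, §2 Lemma 2.1] -/
def selbergBoxLemma : Prop :=
  ∀ (f : ℂ → ℂ) (W₀ W W₁ H : ℝ), Differentiable ℂ f → (∀ z : ℂ, W ≤ z.re → f z ≠ 0) →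
    0 < H → W₀ < W → W < W₁ →
    ∀ Λ : ℝ → ℂ, ContinuousOn Λ (Icc (-H) H) →
      (∀ t ∈ Icc (-H) H, Complex.exp (Λ t) = f ((W₁ : ℂ) + t * I)) →
      4 * H * ∑ᶠ ρ ∈ {ρ : ℂ | f ρ = 0 ∧ ρ ∈ Icc W₀ W₁ ×ℂ Icc (-H) H},
          (analyticOrderNatAt f ρ : ℝ) * SelbergBox.weight W₀ H ρ =
        (∫ t in (-H)..H, Real.cos (Real.pi * t / (2 * H)) * Real.log ‖f ((W₀ : ℂ) + t * I)‖) +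
          (∫ α in W₀..W₁, Real.sinh (Real.pi * (α - W₀) / (2 * H)) *
            Real.log ‖f ((α : ℂ) + H * I) * f ((α : ℂ) - H * I)‖) -
          (∫ t in (-H)..H, SelbergBox.rightKernel W₀ W₁ H t * Λ t).re

namespace SelbergBox

/-- **The detector inequality** read off Lemma 2.1 (PROVED modulo the fact): since every zero enters
the left side with a non-negative weight, for any finite set `Z` of zeros of `f` in the box the
partial sum `4H Σ_{ρ ∈ Z} m(ρ) · weight(ρ)` is at most the right side of Lemma 2.1 — the form in which
Conrey–Soundararajan use it ((2.1): keep only the real zeros `β ≥ 1/2 − R/log X`).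
[cite: ConreySoundararajan2002, §2 (2.1)] -/
theorem finset_sum_le_of_selbergBoxLemma (h : selbergBoxLemma) {f : ℂ → ℂ} {W₀ W W₁ H : ℝ}
    (hf : Differentiable ℂ f) (hW : ∀ z : ℂ, W ≤ z.re → f z ≠ 0) (hH : 0 < H) (h₀ : W₀ < W)
    (h₁ : W < W₁) {Λ : ℝ → ℂ} (hΛ : ContinuousOn Λ (Icc (-H) H))
    (hΛf : ∀ t ∈ Icc (-H) H, Complex.exp (Λ t) = f ((W₁ : ℂ) + t * I))
    (hfin : {ρ : ℂ | f ρ = 0 ∧ ρ ∈ Icc W₀ W₁ ×ℂ Icc (-H) H}.Finite)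
    (Z : Finset ℂ) (hZ : ↑Z ⊆ {ρ : ℂ | f ρ = 0 ∧ ρ ∈ Icc W₀ W₁ ×ℂ Icc (-H) H}) :
    4 * H * ∑ ρ ∈ Z, (analyticOrderNatAt f ρ : ℝ) * weight W₀ H ρ ≤
      (∫ t in (-H)..H, Real.cos (Real.pi * t / (2 * H)) * Real.log ‖f ((W₀ : ℂ) + t * I)‖) +
        (∫ α in W₀..W₁, Real.sinh (Real.pi * (α - W₀) / (2 * H)) *
          Real.log ‖f ((α : ℂ) + H * I) * f ((α : ℂ) - H * I)‖) -
        (∫ t in (-H)..H, rightKernel W₀ W₁ H t * Λ t).re := by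
  rw [← h f W₀ W W₁ H hf hW hH h₀ h₁ Λ hΛ hΛf, finsum_mem_eq_finite_toFinset_sum _ hfin]
  have hZ' : Z ⊆ hfin.toFinset := by
    intro ρ hρ
    rw [Set.Finite.mem_toFinset]
    exact hZ hρ
  refine mul_le_mul_of_nonneg_left ?_ (by linarith)
  apply Finset.sum_le_sum_of_subset_of_nonneg hZ'
  intro ρ hρ _
  have hρ' := (Set.Finite.mem_toFinset hfin).mp hρ
  exact mul_nonneg (Nat.cast_nonneg _) (weight_nonneg (W₁ := W₁) hH hρ'.2)

end SelbergBox

end Literature.Analysis.Complex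

end
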